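import Summits.QuantumFields.YangMills.Theorems.SwapVirialDeficitZeroModeSigmaFourSmallBallRateShell
import Summits.QuantumFields.YangMills.Theorems.ToronValleyVolumeNearlyCommutingCeilingSection
import HarnessLib

/-!
# Exact zero-mode rung Z5 — the σ-TWISTED FOUR-LEADER small ball, VII: the deterministic second-order package for a RATE
# (LEAD ym-line-sfw-p2 g93 07:46Z «`Haar⁴{E_σ(t)} = v₇t⁷(1 + O(t^θ))`»; division of labour with w2 g56 (measure side); free-hands support of ⟨stmt-QuantumFields-24197⟩)

Parts I–VI proved the LIMIT `Haar⁴(E_σ(t))/t⁷ → sigmaV`.  A power RATE needs, on the deterministic side, second-order control of the six relation maps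
`M_i(s)` of part III-a around `s = 0`.  Because the blow-up perturbations are ORTHOGONAL to the base points (`x̄ ⊥ x_⊥`, `z₀ ⊥ ζ`), the unit radial field
has an exact Taylor remainder with constant ONE:
* §38 ★ `norm_radialUnit_add_sub_le` — for `⟪x, h⟫ = 0`, `x ≠ 0`: `‖ν(x + h) − ν(x) − ‖x‖⁻¹·h‖ ≤ ‖h‖²/‖x‖²` (all `h`, no smallness); the letter paths: `Xd x = ‖x̄‖⁻¹·x_⊥`, `Zd z = |z₀|⁻¹·ζ`, `‖X(s) − X(0) − s·Xd‖ ≤ s²a²`,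
  `‖Z(s) − Z(0) − s·Zd‖ ≤ s²c²` with the RATIOS `a = ‖x_⊥‖/‖x̄‖`, `c = ‖ζ‖/|z₀|`;
* §39 the product rule with remainders (`norm_mul_taylor_le`) and ★★ `norm_Mrel_sub_le`: for `0 ≤ s` with `s·(a + b + c) ≤ 1`,
  `‖M_i(s) − M_i(0) − s·L_i‖ ≤ 8·s²·(a + b + c)²` for all six relation maps (`L_i = Lrel`, part III-a);
* §40 ★ the glue to w2 g56's ✓`mem_shell_of_flip` (…SmallBallRateShell): `norm_Mrel_sub_smul_le` `‖M_i(s) − s·L_i‖ ≤ s·(8s(a+b+c)²)` (`z₀ > 0`,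
  axial unit hub), hence ★★ `mem_shell_of_flip_taylor`: a flip between `rescaledSigmaR r s A` and `limSigma r A` lies in the limit shell
  `limSigma (r + 8s(a+b+c)²) A \ limSigma (r − 8s(a+b+c)²) A`; and the BALL AGREEMENT off thin layers: `‖D_s x‖² = ‖x̄‖² + s²‖x_⊥‖²`,
  so `‖D_s x‖ < 1 ↔ ‖x̄‖ < 1` unless `1 − s²‖x_⊥‖² ≤ ‖x̄‖² < 1` (`dilate_ball_iff`, `dilateIm_ball_iff`).
The measure-side bookkeeping (thin shells of `‖L_i‖` against the dominator, the region `s(a+b+c) > 1`, the hub) is w2 g56's.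
HONEST LABEL: deterministic finite-dimensional calculus (plan-level zero-mode rung of the DRAFT line «sharp-sigma»); no rate is proved HERE; NOT ⟨24197⟩;
own crux ⟨22884⟩ OPEN (blocked-on ⟨19935⟩); the Yang–Mills mass gap is NOT proved; no summit is proved by a line.
Width seat ym-line-sfw-p2-w3 g63 (cell ym-idea-1, free hands), `--supports stmt-QuantumFields-24197`.  THEOREMS ONLY, standard axioms, 0 `sorry`.
References: [cite: GonzalezarroyoAltes1988]; [cite: Vanbaal2001]; [cite: Luscher1983, §2]; [folklore].
-/

set_option autoImplicit false

noncomputable section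

open MeasureTheory Quaternion Set Filter Topology
open scoped Quaternion ENNReal BigOperators RealInnerProductSpace
open Literature.MathematicalPhysics.QuantumLattice
open Literature.Analysis.Calculus (radialUnit radialUnit_def norm_radialUnit tangentialProj tangentialProj_apply tangentialProj_eq_self)
open Summit.QuantumFields.YangMills.Theorems.SwapTwistDeficit.ToronLog
open Summit.QuantumFields.YangMills.Theorems.SwapVirialDeficit.ZeroModeGroup
open Summit.QuantumFields.YangMills.Theorems.ToronValleyVolume.NearlyCommutingCeiling (norm_conj_of_norm_eq_one)

attribute [local instance] Literature.Analysis.FluidPDE.Tao2016.quatMeasurableSpace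
  Literature.Analysis.FluidPDE.Tao2016.quatBorelSpace
  Literature.MathematicalPhysics.QuantumLattice.secondCountableTopology_su2

namespace Summit.QuantumFields.YangMills.Theorems.SwapVirialDeficit.ZeroModeSigma

/-! ## §38 The orthogonal Taylor remainder of the unit radial field -/

/-- ★ **Orthogonal Taylor remainder of `ν(x) = x/‖x‖` with constant one**: for `x ≠ 0` and `h ⊥ x`,
`‖ν(x + h) − ν(x) − ‖x‖⁻¹·h‖ ≤ ‖h‖²/‖x‖²` — for ALL `h` (here `‖x + h‖² = ‖x‖² + ‖h‖²`, and the remainder is `(x + h)(1/‖x+h‖ − 1/‖x‖)`).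
[folklore] -/
theorem norm_radialUnit_add_sub_le {x h : ℍ} (hx : x ≠ 0) (horth : ⟪x, h⟫ = 0) :
    ‖radialUnit (x + h) - radialUnit x - ‖x‖⁻¹ • h‖ ≤ ‖h‖ ^ 2 / ‖x‖ ^ 2 := by
  have hn : 0 < ‖x‖ := norm_pos_iff.2 hx
  have hsq : ‖x + h‖ ^ 2 = ‖x‖ ^ 2 + ‖h‖ ^ 2 := by rw [sq, sq, sq]; exact norm_add_sq_eq_norm_sq_add_norm_sq_real horth
  have hm : ‖x‖ ≤ ‖x + h‖ := by nlinarith [norm_nonneg (x + h), norm_nonneg h, norm_nonneg x]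
  have hm0 : 0 < ‖x + h‖ := lt_of_lt_of_le hn hm
  -- the remainder is `(‖x+h‖⁻¹ − ‖x‖⁻¹) • (x + h)`
  have e : radialUnit (x + h) - radialUnit x - ‖x‖⁻¹ • h = (‖x + h‖⁻¹ - ‖x‖⁻¹) • (x + h) := by
    simp only [radialUnit_def, sub_smul, smul_add]; abel
  rw [e, norm_smul, Real.norm_eq_abs]
  -- `|1/m − 1/n|·m = (m − n)/n = (m² − n²)/(n(m+n)) = ‖h‖²/(n(m+n)) ≤ ‖h‖²/n²`
  have h1 : |‖x + h‖⁻¹ - ‖x‖⁻¹| = (‖x + h‖ - ‖x‖) / (‖x + h‖ * ‖x‖) := by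
    rw [abs_of_nonpos (by rw [sub_nonpos]; exact inv_anti₀ hn hm), neg_sub, inv_sub_inv hn.ne' hm0.ne', div_eq_div_iff (by positivity) (by positivity)]
    ring
  rw [h1]
  have h2 : (‖x + h‖ - ‖x‖) * (‖x + h‖ + ‖x‖) = ‖h‖ ^ 2 := by nlinarith [hsq]
  have h3 : ‖x + h‖ - ‖x‖ = ‖h‖ ^ 2 / (‖x + h‖ + ‖x‖) := by
    rw [eq_div_iff (by positivity)]; exact h2
  rw [h3]
  have e2 : ‖h‖ ^ 2 / (‖x + h‖ + ‖x‖) / (‖x + h‖ * ‖x‖) * ‖x + h‖ = ‖h‖ ^ 2 / ((‖x + h‖ + ‖x‖) * ‖x‖) := by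
    field_simp
  rw [e2]
  have h4 : ‖x‖ ^ 2 ≤ (‖x + h‖ + ‖x‖) * ‖x‖ := by nlinarith
  exact div_le_div_of_nonneg_left (sq_nonneg _) (by positivity) h4

/-- The transversal part is orthogonal to the axial part. [folklore] -/
theorem inner_axPart_trPart (x : ℍ) : ⟪axPart x, trPart x⟫ = 0 := by
  rw [Quaternion.inner_def]; simp [axPart, trPart]

/-- `Im z` is orthogonal to the real part. [folklore] -/
theorem inner_coe_re_im (z : ℍ) : ⟪(z.re : ℍ), z.im⟫ = 0 := by
  rw [Quaternion.inner_def]; simp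

/-- ★ The derivative of the pair-letter path is the transversal part over the axial norm: `Xd x = ‖x̄‖⁻¹·x_⊥`. [folklore] -/
theorem Xd_eq (x : ℍ) : Xd x = ‖axPart x‖⁻¹ • trPart x := by
  unfold Xd
  rw [show (‖axPart x‖⁻¹ • tangentialProj (axPart x)) (trPart x) = ‖axPart x‖⁻¹ • tangentialProj (axPart x) (trPart x) from rfl,
    tangentialProj_eq_self (inner_axPart_trPart x)]

/-- ★ `Zd z = ‖(z₀ : ℍ)‖⁻¹·Im z`. [folklore] -/
theorem Zd_eq (z : ℍ) : Zd z = ‖(z.re : ℍ)‖⁻¹ • z.im := by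
  unfold Zd
  rw [show (‖(z.re : ℍ)‖⁻¹ • tangentialProj (z.re : ℍ)) z.im = ‖(z.re : ℍ)‖⁻¹ • tangentialProj (z.re : ℍ) z.im from rfl,
    tangentialProj_eq_self (inner_coe_re_im z)]

/-- **The ratio `a = ‖x_⊥‖/‖x̄‖`** of a pair letter. [folklore] -/
def trRatio (x : ℍ) : ℝ := ‖trPart x‖ / ‖axPart x‖

/-- **The ratio `c = ‖ζ‖/|z₀|`** of the slaved letter. [folklore] -/
def imRatio (z : ℍ) : ℝ := ‖z.im‖ / ‖(z.re : ℍ)‖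

/-- The ratios are non-negative. [folklore] -/
theorem ratios_nonneg (x z : ℍ) : 0 ≤ trRatio x ∧ 0 ≤ imRatio z := ⟨div_nonneg (norm_nonneg _) (norm_nonneg _), div_nonneg (norm_nonneg _) (norm_nonneg _)⟩

/-- `‖Xd x‖ = a`. [folklore] -/
theorem norm_Xd (x : ℍ) : ‖Xd x‖ = trRatio x := by
  rw [Xd_eq, norm_smul, norm_inv, norm_norm, trRatio, div_eq_inv_mul]

/-- `‖Zd z‖ = c`. [folklore] -/
theorem norm_Zd (z : ℍ) : ‖Zd z‖ = imRatio z := by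
  rw [Zd_eq, norm_smul, norm_inv, norm_norm, imRatio, div_eq_inv_mul]

/-- `‖Wd‖ ≤ a + c` for a unit hub. [folklore] -/
theorem norm_Wd_le {A : ℍ} (hA : ‖A‖ = 1) (x z : ℍ) : ‖Wd A x z‖ ≤ trRatio x + imRatio z := by
  rw [Wd]
  calc ‖star A * Xd x * A * radialUnit (z.re : ℍ) + star A * radialUnit (axPart x) * A * Zd z‖
      ≤ ‖star A * Xd x * A * radialUnit (z.re : ℍ)‖ + ‖star A * radialUnit (axPart x) * A * Zd z‖ := norm_add_le _ _
    _ ≤ ‖star A * Xd x * A‖ * ‖radialUnit (z.re : ℍ)‖ + ‖star A * radialUnit (axPart x) * A‖ * ‖Zd z‖ :=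
        add_le_add (norm_mul_le _ _) (norm_mul_le _ _)
    _ = ‖Xd x‖ * ‖radialUnit (z.re : ℍ)‖ + ‖radialUnit (axPart x)‖ * ‖Zd z‖ := by rw [norm_conj_of_norm_eq_one hA, norm_conj_of_norm_eq_one hA]
    _ ≤ trRatio x * 1 + 1 * imRatio z := by
        rw [norm_Xd, norm_Zd]
        exact add_le_add (mul_le_mul_of_nonneg_left (norm_radialUnit_le_one _) (ratios_nonneg x z).1)
          (mul_le_mul_of_nonneg_right (norm_radialUnit_le_one _) (ratios_nonneg x z).2)
    _ = trRatio x + imRatio z := by ring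

/-- ★ **Second-order remainder of `X`**: `‖X(s) − X(0) − s·Xd‖ ≤ s²a²` (all `s`, `x̄ ≠ 0`). [folklore] -/
theorem norm_Xp_taylor {x : ℍ} (hx : axPart x ≠ 0) (s : ℝ) : ‖Xp x s - Xp x 0 - s • Xd x‖ ≤ s ^ 2 * trRatio x ^ 2 := by
  have horth : ⟪axPart x, s • trPart x⟫ = 0 := by rw [inner_smul_right, inner_axPart_trPart, mul_zero]
  have h := norm_radialUnit_add_sub_le hx horth
  rw [Xp, Xp_zero, Xd_eq]
  rw [smul_comm s, show ‖axPart x‖⁻¹ • s • trPart x = ‖axPart x‖⁻¹ • (s • trPart x) from rfl]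
  refine h.trans (le_of_eq ?_)
  rw [norm_smul, Real.norm_eq_abs, trRatio, mul_pow, div_pow, sq_abs]; ring

/-- ★ **Second-order remainder of `Z`**: `‖Z(s) − Z(0) − s·Zd‖ ≤ s²c²` (all `s`, `z₀ ≠ 0`). [folklore] -/
theorem norm_Zp_taylor {z : ℍ} (hz : z.re ≠ 0) (s : ℝ) : ‖Zp z s - Zp z 0 - s • Zd z‖ ≤ s ^ 2 * imRatio z ^ 2 := by
  have hne : (z.re : ℍ) ≠ 0 := by rwa [Ne, ← Quaternion.coe_zero, Quaternion.coe_inj]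
  have horth : ⟪(z.re : ℍ), s • z.im⟫ = 0 := by rw [inner_smul_right, inner_coe_re_im, mul_zero]
  have h := norm_radialUnit_add_sub_le hne horth
  rw [Zp, Zp_zero, Zd_eq]
  rw [smul_comm s, show ‖(z.re : ℍ)‖⁻¹ • s • z.im = ‖(z.re : ℍ)‖⁻¹ • (s • z.im) from rfl]
  refine h.trans (le_of_eq ?_)
  rw [norm_smul, Real.norm_eq_abs, imRatio, mul_pow, div_pow, sq_abs]; ring

/-- First-order bound for `X`: `‖X(s) − X(0)‖ ≤ 2sa` when `0 ≤ s`, `sa ≤ 1`. [folklore] -/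
theorem norm_Xp_sub_le {x : ℍ} (hx : axPart x ≠ 0) {s : ℝ} (hs : 0 ≤ s) (hsa : s * trRatio x ≤ 1) : ‖Xp x s - Xp x 0‖ ≤ 2 * (s * trRatio x) := by
  have h := norm_Xp_taylor hx s
  have ha := (ratios_nonneg x 0).1
  have e : Xp x s - Xp x 0 = (Xp x s - Xp x 0 - s • Xd x) + s • Xd x := by abel
  rw [e]
  calc ‖(Xp x s - Xp x 0 - s • Xd x) + s • Xd x‖ ≤ ‖Xp x s - Xp x 0 - s • Xd x‖ + ‖s • Xd x‖ := norm_add_le _ _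
    _ ≤ s ^ 2 * trRatio x ^ 2 + s * trRatio x := by rw [norm_smul, Real.norm_eq_abs, abs_of_nonneg hs, norm_Xd]; exact add_le_add h le_rfl
    _ ≤ 2 * (s * trRatio x) := by nlinarith [mul_nonneg hs ha]

/-- First-order bound for `Z`: `‖Z(s) − Z(0)‖ ≤ 2sc` when `0 ≤ s`, `sc ≤ 1`. [folklore] -/
theorem norm_Zp_sub_le {z : ℍ} (hz : z.re ≠ 0) {s : ℝ} (hs : 0 ≤ s) (hsc : s * imRatio z ≤ 1) : ‖Zp z s - Zp z 0‖ ≤ 2 * (s * imRatio z) := by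
  have h := norm_Zp_taylor hz s
  have hc := (ratios_nonneg 0 z).2
  have e : Zp z s - Zp z 0 = (Zp z s - Zp z 0 - s • Zd z) + s • Zd z := by abel
  rw [e]
  calc ‖(Zp z s - Zp z 0 - s • Zd z) + s • Zd z‖ ≤ ‖Zp z s - Zp z 0 - s • Zd z‖ + ‖s • Zd z‖ := norm_add_le _ _
    _ ≤ s ^ 2 * imRatio z ^ 2 + s * imRatio z := by rw [norm_smul, Real.norm_eq_abs, abs_of_nonneg hs, norm_Zd]; exact add_le_add h le_rfl
    _ ≤ 2 * (s * imRatio z) := by nlinarith [mul_nonneg hs hc]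

/-! ## §39 The product rule with remainders; the six relation maps -/

/-- **Product rule with remainders** (pure normed-ring algebra): `‖XY − X₀Y₀ − s(X'Y₀ + X₀Y')‖ ≤ ‖X − X₀ − sX'‖·‖Y‖ + ‖X₀‖·‖Y − Y₀ − sY'‖ + |s|·‖X'‖·‖Y − Y₀‖`.
[folklore] -/
theorem norm_mul_taylor_le (X X₀ X' Y Y₀ Y' : ℍ) (s : ℝ) :
    ‖X * Y - X₀ * Y₀ - s • (X' * Y₀ + X₀ * Y')‖ ≤ ‖X - X₀ - s • X'‖ * ‖Y‖ + ‖X₀‖ * ‖Y - Y₀ - s • Y'‖ + |s| * ‖X'‖ * ‖Y - Y₀‖ := by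
  have e : X * Y - X₀ * Y₀ - s • (X' * Y₀ + X₀ * Y') = (X - X₀ - s • X') * Y + X₀ * (Y - Y₀ - s • Y') + (s • X') * (Y - Y₀) := by
    simp only [sub_mul, mul_sub, smul_mul_assoc, mul_smul_comm, smul_add]; abel
  rw [e]
  calc ‖(X - X₀ - s • X') * Y + X₀ * (Y - Y₀ - s • Y') + (s • X') * (Y - Y₀)‖
      ≤ ‖(X - X₀ - s • X') * Y‖ + ‖X₀ * (Y - Y₀ - s • Y')‖ + ‖(s • X') * (Y - Y₀)‖ := norm_add₃_le
    _ ≤ ‖X - X₀ - s • X'‖ * ‖Y‖ + ‖X₀‖ * ‖Y - Y₀ - s • Y'‖ + |s| * ‖X'‖ * ‖Y - Y₀‖ := by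
        refine add_le_add (add_le_add (norm_mul_le _ _) (norm_mul_le _ _)) ?_
        calc ‖(s • X') * (Y - Y₀)‖ ≤ ‖s • X'‖ * ‖Y - Y₀‖ := norm_mul_le _ _
          _ = |s| * ‖X'‖ * ‖Y - Y₀‖ := by rw [norm_smul, Real.norm_eq_abs]

/-- Norm bounds of the paths: `‖X(s)‖ ≤ 1`, `‖Z(s)‖ ≤ 1`, `‖W(s)‖ ≤ 1` for a unit hub. [folklore] -/
theorem norm_paths_le_one {A : ℍ} (hA : ‖A‖ = 1) (x z : ℍ) (s : ℝ) : ‖Xp x s‖ ≤ 1 ∧ ‖Zp z s‖ ≤ 1 ∧ ‖Wp A x z s‖ ≤ 1 := by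
  have h1 : ‖Xp x s‖ ≤ 1 := norm_radialUnit_le_one _
  have h2 : ‖Zp z s‖ ≤ 1 := norm_radialUnit_le_one _
  refine ⟨h1, h2, ?_⟩
  rw [Wp]
  calc ‖star A * Xp x s * A * Zp z s‖ ≤ ‖star A * Xp x s * A‖ * ‖Zp z s‖ := norm_mul_le _ _
    _ ≤ 1 * 1 := by
        refine mul_le_mul ?_ h2 (norm_nonneg _) zero_le_one
        calc ‖star A * Xp x s * A‖ ≤ ‖star A * Xp x s‖ * ‖A‖ := norm_mul_le _ _
          _ ≤ (‖star A‖ * ‖Xp x s‖) * ‖A‖ := by gcongr; exact norm_mul_le _ _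
          _ ≤ (1 * 1) * 1 := by rw [norm_star, hA]; gcongr
          _ = 1 := by norm_num
    _ = 1 := one_mul _

/-- ★ **Second-order remainder of the slaved letter `W = (Ā X A)·Z`**: `‖W(s) − W(0) − s·Wd‖ ≤ s²(a + c)²` and `‖W(s) − W(0)‖ ≤ 2s(a + c)` for `0 ≤ s`,
`s(a + c) ≤ 1` (unit hub). [folklore] -/
theorem norm_Wp_taylor {A : ℍ} (hA : ‖A‖ = 1) {x z : ℍ} (hx : axPart x ≠ 0) (hz : z.re ≠ 0) {s : ℝ} (hs : 0 ≤ s)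
    (hsR : s * (trRatio x + imRatio z) ≤ 1) :
    ‖Wp A x z s - Wp A x z 0 - s • Wd A x z‖ ≤ s ^ 2 * (trRatio x + imRatio z) ^ 2 ∧ ‖Wp A x z s - Wp A x z 0‖ ≤ 2 * (s * (trRatio x + imRatio z)) := by
  obtain ⟨ha, hc⟩ := ratios_nonneg x z
  have hsa : s * trRatio x ≤ 1 := by nlinarith [mul_nonneg hs hc]
  have hsc : s * imRatio z ≤ 1 := by nlinarith [mul_nonneg hs ha]
  -- the conjugated path `P = Ā X A`
  have hP : ‖star A * Xp x s * A - star A * Xp x 0 * A - s • (star A * Xd x * A)‖ ≤ s ^ 2 * trRatio x ^ 2 := by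
    have e : star A * Xp x s * A - star A * Xp x 0 * A - s • (star A * Xd x * A) = star A * (Xp x s - Xp x 0 - s • Xd x) * A := by
      simp only [mul_sub, sub_mul, mul_smul_comm, smul_mul_assoc]
    rw [e, norm_conj_of_norm_eq_one hA]
    exact norm_Xp_taylor hx s
  have hP0 : ‖star A * Xp x 0 * A‖ ≤ 1 := by rw [norm_conj_of_norm_eq_one hA]; exact norm_radialUnit_le_one _
  have hP' : ‖star A * Xd x * A‖ ≤ trRatio x := by rw [norm_conj_of_norm_eq_one hA, norm_Xd]
  have hZ := norm_Zp_taylor hz s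
  have hZ1 := norm_Zp_sub_le hz hs hsc
  have hZb : ‖Zp z s‖ ≤ 1 := norm_radialUnit_le_one _
  have hmain := norm_mul_taylor_le (star A * Xp x s * A) (star A * Xp x 0 * A) (star A * Xd x * A) (Zp z s) (Zp z 0) (Zd z) s
  have eW : Wd A x z = star A * Xd x * A * Zp z 0 + star A * Xp x 0 * A * Zd z := by rw [Wd, Zp_zero, Xp_zero]
  have hrem : ‖Wp A x z s - Wp A x z 0 - s • Wd A x z‖ ≤ s ^ 2 * (trRatio x + imRatio z) ^ 2 := by
    rw [Wp, Wp, eW]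
    refine hmain.trans ?_
    rw [abs_of_nonneg hs]
    calc ‖star A * Xp x s * A - star A * Xp x 0 * A - s • (star A * Xd x * A)‖ * ‖Zp z s‖ +
          ‖star A * Xp x 0 * A‖ * ‖Zp z s - Zp z 0 - s • Zd z‖ + s * ‖star A * Xd x * A‖ * ‖Zp z s - Zp z 0‖
        ≤ s ^ 2 * trRatio x ^ 2 * 1 + 1 * (s ^ 2 * imRatio z ^ 2) + s * trRatio x * (2 * (s * imRatio z)) := by
          gcongr
      _ ≤ s ^ 2 * (trRatio x + imRatio z) ^ 2 := by nlinarith [mul_nonneg ha hc, sq_nonneg s]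
  refine ⟨hrem, ?_⟩
  have hWd : ‖Wd A x z‖ ≤ trRatio x + imRatio z := norm_Wd_le hA x z
  have e : Wp A x z s - Wp A x z 0 = (Wp A x z s - Wp A x z 0 - s • Wd A x z) + s • Wd A x z := by abel
  rw [e]
  calc ‖(Wp A x z s - Wp A x z 0 - s • Wd A x z) + s • Wd A x z‖ ≤ ‖Wp A x z s - Wp A x z 0 - s • Wd A x z‖ + ‖s • Wd A x z‖ := norm_add_le _ _
    _ ≤ s ^ 2 * (trRatio x + imRatio z) ^ 2 + s * (trRatio x + imRatio z) := by
        rw [norm_smul, Real.norm_eq_abs, abs_of_nonneg hs]; exact add_le_add hrem (mul_le_mul_of_nonneg_left hWd hs)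
    _ ≤ 2 * (s * (trRatio x + imRatio z)) := by nlinarith [mul_nonneg hs (add_nonneg ha hc)]

/-- **Commutator remainder, abstract form**: if `P, Q` have second-order remainders `s²p², s²q²`, norms `≤ 1`, derivative norms `≤ p, q` and
increments `≤ 2sp, 2sq`, then `‖[P,Q](s) − [P,Q](0) − s·[P,Q]'‖ ≤ 2s²(p + q)²`. [folklore] -/
theorem norm_comm_taylor_le {P P₀ P' Q Q₀ Q' : ℍ} {s p q : ℝ} (hs : 0 ≤ s)
    (rP : ‖P - P₀ - s • P'‖ ≤ s ^ 2 * p ^ 2) (rQ : ‖Q - Q₀ - s • Q'‖ ≤ s ^ 2 * q ^ 2)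
    (nP : ‖P‖ ≤ 1) (nP₀ : ‖P₀‖ ≤ 1) (nQ : ‖Q‖ ≤ 1) (nQ₀ : ‖Q₀‖ ≤ 1) (nP' : ‖P'‖ ≤ p) (nQ' : ‖Q'‖ ≤ q)
    (dP : ‖P - P₀‖ ≤ 2 * (s * p)) (dQ : ‖Q - Q₀‖ ≤ 2 * (s * q)) :
    ‖(P * Q - Q * P) - (P₀ * Q₀ - Q₀ * P₀) - s • ((P' * Q₀ + P₀ * Q') - (Q' * P₀ + Q₀ * P'))‖ ≤ 2 * (s ^ 2 * (p + q) ^ 2) := by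
  have hp : 0 ≤ p := (norm_nonneg _).trans nP'
  have hq : 0 ≤ q := (norm_nonneg _).trans nQ'
  have e : (P * Q - Q * P) - (P₀ * Q₀ - Q₀ * P₀) - s • ((P' * Q₀ + P₀ * Q') - (Q' * P₀ + Q₀ * P')) =
      (P * Q - P₀ * Q₀ - s • (P' * Q₀ + P₀ * Q')) - (Q * P - Q₀ * P₀ - s • (Q' * P₀ + Q₀ * P')) := by
    simp only [smul_sub, smul_add]; abel
  rw [e]
  have h1 := norm_mul_taylor_le P P₀ P' Q Q₀ Q' s
  have h2 := norm_mul_taylor_le Q Q₀ Q' P P₀ P' s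
  rw [abs_of_nonneg hs] at h1 h2
  calc ‖(P * Q - P₀ * Q₀ - s • (P' * Q₀ + P₀ * Q')) - (Q * P - Q₀ * P₀ - s • (Q' * P₀ + Q₀ * P'))‖
      ≤ ‖P * Q - P₀ * Q₀ - s • (P' * Q₀ + P₀ * Q')‖ + ‖Q * P - Q₀ * P₀ - s • (Q' * P₀ + Q₀ * P')‖ := norm_sub_le _ _
    _ ≤ (s ^ 2 * p ^ 2 * 1 + 1 * (s ^ 2 * q ^ 2) + s * p * (2 * (s * q))) +
          (s ^ 2 * q ^ 2 * 1 + 1 * (s ^ 2 * p ^ 2) + s * q * (2 * (s * p))) := by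
        refine add_le_add (h1.trans ?_) (h2.trans ?_)
        · exact add_le_add (add_le_add (mul_le_mul rP nQ (norm_nonneg _) (by positivity)) (mul_le_mul nP₀ rQ (norm_nonneg _) zero_le_one))
            (mul_le_mul (mul_le_mul_of_nonneg_left nP' hs) dQ (norm_nonneg _) (by positivity))
        · exact add_le_add (add_le_add (mul_le_mul rQ nP (norm_nonneg _) (by positivity)) (mul_le_mul nQ₀ rP (norm_nonneg _) zero_le_one))
            (mul_le_mul (mul_le_mul_of_nonneg_left nQ' hs) dP (norm_nonneg _) (by positivity))
    _ = 2 * (s ^ 2 * (p + q) ^ 2) := by ring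

/-- **Conjugation-relation remainder, abstract form**: `‖(AP − QA)(s) − (AP − QA)(0) − s·(AP' − Q'A)‖ ≤ s²p² + s²q²` for a unit `A`.
[folklore] -/
theorem norm_conjRel_taylor_le {A P P₀ P' Q Q₀ Q' : ℍ} (hA : ‖A‖ = 1) {s p q : ℝ}
    (rP : ‖P - P₀ - s • P'‖ ≤ s ^ 2 * p ^ 2) (rQ : ‖Q - Q₀ - s • Q'‖ ≤ s ^ 2 * q ^ 2) :
    ‖(A * P - Q * A) - (A * P₀ - Q₀ * A) - s • (A * P' - Q' * A)‖ ≤ s ^ 2 * p ^ 2 + s ^ 2 * q ^ 2 := by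
  have e : (A * P - Q * A) - (A * P₀ - Q₀ * A) - s • (A * P' - Q' * A) = A * (P - P₀ - s • P') - (Q - Q₀ - s • Q') * A := by
    simp only [smul_sub, mul_sub, sub_mul, mul_smul_comm, smul_mul_assoc]; abel
  rw [e]
  calc ‖A * (P - P₀ - s • P') - (Q - Q₀ - s • Q') * A‖ ≤ ‖A * (P - P₀ - s • P')‖ + ‖(Q - Q₀ - s • Q') * A‖ := norm_sub_le _ _
    _ ≤ ‖A‖ * ‖P - P₀ - s • P'‖ + ‖Q - Q₀ - s • Q'‖ * ‖A‖ := add_le_add (norm_mul_le _ _) (norm_mul_le _ _)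
    _ ≤ s ^ 2 * p ^ 2 + s ^ 2 * q ^ 2 := by rw [hA, one_mul, mul_one]; exact add_le_add rP rQ

/-- Arithmetic: `2s²p² ≤ 8s²R²` for `0 ≤ p ≤ 2R`. [folklore] -/
theorem two_mul_sq_le {s p R : ℝ} (hp : 0 ≤ p) (hpR : p ≤ 2 * R) : 2 * (s ^ 2 * p ^ 2) ≤ 8 * s ^ 2 * R ^ 2 := by
  have h : p * p ≤ (2 * R) * (2 * R) := mul_self_le_mul_self hp hpR
  nlinarith [mul_nonneg (sq_nonneg s) (sub_nonneg.2 h)]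

/-- Arithmetic: `s²p² + s²q² ≤ 8s²R²` for `0 ≤ p, q ≤ R`. [folklore] -/
theorem sq_add_sq_le_eight {s p q R : ℝ} (hp : 0 ≤ p) (hpR : p ≤ R) (hq : 0 ≤ q) (hqR : q ≤ R) :
    s ^ 2 * p ^ 2 + s ^ 2 * q ^ 2 ≤ 8 * s ^ 2 * R ^ 2 := by
  have h1 : p * p ≤ R * R := mul_self_le_mul_self hp hpR
  have h2 : q * q ≤ R * R := mul_self_le_mul_self hq hqR
  nlinarith [mul_nonneg (sq_nonneg s) (sub_nonneg.2 h1), mul_nonneg (sq_nonneg s) (sub_nonneg.2 h2),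
    mul_nonneg (sq_nonneg s) (mul_self_nonneg R)]

/-- ★★ **SECOND-ORDER CONTROL OF THE SIX RELATION MAPS**: for a unit hub `A`, `x̄, ȳ ≠ 0`, `z₀ ≠ 0`, `0 ≤ s` and `s·(a + b + c) ≤ 1`
(`a = ‖x_⊥‖/‖x̄‖`, `b = ‖y_⊥‖/‖ȳ‖`, `c = ‖ζ‖/|z₀|`): `‖M_i(s) − M_i(0) − s·L_i‖ ≤ 8·s²·(a + b + c)²` for all six `i`. [folklore] -/
theorem norm_Mrel_sub_le {A : ℍ} (hA : ‖A‖ = 1) {x y z : ℍ} (hx : axPart x ≠ 0) (hy : axPart y ≠ 0) (hz : z.re ≠ 0) {s : ℝ} (hs : 0 ≤ s)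
    (hsR : s * (trRatio x + trRatio y + imRatio z) ≤ 1) (i : Fin 6) :
    ‖Mrel A x y z i s - Mrel A x y z i 0 - s • Lrel A x y z i‖ ≤ 8 * s ^ 2 * (trRatio x + trRatio y + imRatio z) ^ 2 := by
  obtain ⟨ha, hc⟩ := ratios_nonneg x z
  have hb := (ratios_nonneg y z).1
  have hsa : s * trRatio x ≤ 1 := by nlinarith [mul_nonneg hs hb, mul_nonneg hs hc]
  have hsb : s * trRatio y ≤ 1 := by nlinarith [mul_nonneg hs ha, mul_nonneg hs hc]
  have hsac : s * (trRatio x + imRatio z) ≤ 1 := by nlinarith [mul_nonneg hs hb]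
  have rX := norm_Xp_taylor hx s
  have rY := norm_Xp_taylor hy s
  have dX := norm_Xp_sub_le hx hs hsa
  have dY := norm_Xp_sub_le hy hs hsb
  obtain ⟨rW, dW⟩ := norm_Wp_taylor hA hx hz hs hsac
  have nX : ‖Xp x s‖ ≤ 1 := norm_radialUnit_le_one _
  have nY : ‖Xp y s‖ ≤ 1 := norm_radialUnit_le_one _
  have nX0 : ‖Xp x 0‖ ≤ 1 := norm_radialUnit_le_one _
  have nY0 : ‖Xp y 0‖ ≤ 1 := norm_radialUnit_le_one _
  have nW : ‖Wp A x z s‖ ≤ 1 := (norm_paths_le_one hA x z s).2.2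
  have nW0 : ‖Wp A x z 0‖ ≤ 1 := (norm_paths_le_one hA x z 0).2.2
  have nXd : ‖Xd x‖ ≤ trRatio x := (norm_Xd x).le
  have nYd : ‖Xd y‖ ≤ trRatio y := (norm_Xd y).le
  have nWd : ‖Wd A x z‖ ≤ trRatio x + imRatio z := norm_Wd_le hA x z
  match i with
  | 0 => exact (norm_comm_taylor_le hs rX rW nX nX0 nW nW0 nXd nWd dX dW).trans (two_mul_sq_le (by positivity) (by linarith))
  | 1 => exact (norm_comm_taylor_le hs rX rY nX nX0 nY nY0 nXd nYd dX dY).trans (two_mul_sq_le (by positivity) (by linarith))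
  | 2 => exact (norm_comm_taylor_le hs rW rY nW nW0 nY nY0 nWd nYd dW dY).trans (two_mul_sq_le (by positivity) (by linarith))
  | 3 => exact (norm_conjRel_taylor_le hA rW rX).trans (sq_add_sq_le_eight (by positivity) (by linarith) ha (by linarith))
  | 4 => exact (norm_conjRel_taylor_le hA rX rW).trans (sq_add_sq_le_eight ha (by linarith) (by positivity) (by linarith))
  | 5 => exact (norm_conjRel_taylor_le hA rY rY).trans (sq_add_sq_le_eight hb (by linarith) hb (by linarith))

/-! ## §40 Slope control and ball agreement in the shape used by the flip/shell bookkeeping (✓`mem_shell_of_flip`, w2 g56) -/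

/-- ★ **Slope control of the six relation maps** in the shape of ✓`mem_shell_of_flip`: for `z₀ > 0`, an axial unit hub, `x̄, ȳ ≠ 0`, `0 ≤ s` and
`s(a+b+c) ≤ 1`: `‖M_i(s) − s·L_i‖ ≤ s·(8s(a+b+c)²)` (`M_i(0) = 0` by ✓`Mrel_zero_of_pos`). [folklore] -/
theorem norm_Mrel_sub_smul_le {A : ℍ} (hA : ‖A‖ = 1) (hJ : A.imJ = 0) (hK : A.imK = 0) {x y z : ℍ} (hx : axPart x ≠ 0) (hy : axPart y ≠ 0)
    (hz : 0 < z.re) {s : ℝ} (hs : 0 ≤ s) (hsR : s * (trRatio x + trRatio y + imRatio z) ≤ 1) (i : Fin 6) :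
    ‖Mrel A x y z i s - s • Lrel A x y z i‖ ≤ s * (8 * s * (trRatio x + trRatio y + imRatio z) ^ 2) := by
  have hT := norm_Mrel_sub_le hA hx hy hz.ne' hs hsR i
  rw [Mrel_zero_of_pos hA hJ hK x y hz i, sub_zero] at hT
  calc ‖Mrel A x y z i s - s • Lrel A x y z i‖ ≤ 8 * s ^ 2 * (trRatio x + trRatio y + imRatio z) ^ 2 := hT
    _ = s * (8 * s * (trRatio x + trRatio y + imRatio z) ^ 2) := by ring

/-- ★★ **FLIPS LIE IN THE TAYLOR SHELL** (✓`mem_shell_of_flip` + `norm_Mrel_sub_smul_le`): at a point `w = ((x,y),z)` with `z₀ > 0`, `x̄, ȳ ≠ 0`,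
`0 < s`, `s(a+b+c) ≤ 1`, axial unit hub `A`, where the three ball conditions at scale `s` agree with their limits, a disagreement between
`w ∈ rescaledSigmaR r s A` and `w ∈ limSigma r A` forces `w ∈ limSigma (r + 8s(a+b+c)²) A \ limSigma (r − 8s(a+b+c)²) A`. [folklore] -/
theorem mem_shell_of_flip_taylor {r s : ℝ} {A : ℍ} (hA : ‖A‖ = 1) (hJ : A.imJ = 0) (hK : A.imK = 0) (hs : 0 < s) {w : (ℍ × ℍ) × ℍ}
    (hx : axPart w.1.1 ≠ 0) (hy : axPart w.1.2 ≠ 0) (hz : 0 < w.2.re) (hsR : s * (trRatio w.1.1 + trRatio w.1.2 + imRatio w.2) ≤ 1)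
    (hbx : ‖dilate s w.1.1‖ < 1 ↔ ‖axPart w.1.1‖ < 1) (hby : ‖dilate s w.1.2‖ < 1 ↔ ‖axPart w.1.2‖ < 1)
    (hbz : ‖dilateIm s w.2‖ < 1 ↔ ‖(w.2.re : ℍ)‖ < 1) (hflip : ¬ (w ∈ rescaledSigmaR r s A ↔ w ∈ limSigma r A)) :
    w ∈ limSigma (r + 8 * s * (trRatio w.1.1 + trRatio w.1.2 + imRatio w.2) ^ 2) A \
      limSigma (r - 8 * s * (trRatio w.1.1 + trRatio w.1.2 + imRatio w.2) ^ 2) A :=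
  mem_shell_of_flip hs hz (fun i => norm_Mrel_sub_smul_le hA hJ hK hx hy hz hs.le hsR i) hbx hby hbz hflip

/-- `‖D_s x‖² = ‖x̄‖² + s²‖x_⊥‖²` (orthogonality of the axial and transversal parts). [folklore] -/
theorem norm_dilate_sq (s : ℝ) (x : ℍ) : ‖dilate s x‖ ^ 2 = ‖axPart x‖ ^ 2 + s ^ 2 * ‖trPart x‖ ^ 2 := by
  have horth : ⟪axPart x, s • trPart x⟫ = 0 := by rw [inner_smul_right, inner_axPart_trPart, mul_zero]
  have h := norm_add_sq_eq_norm_sq_add_norm_sq_real horth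
  rw [dilate_eq_axPart_add, sq, h, norm_smul, Real.norm_eq_abs, sq, sq, sq, ← abs_mul_abs_self s]; ring

/-- `‖D³_s z‖² = z₀² + s²‖ζ‖²`. [folklore] -/
theorem norm_dilateIm_sq (s : ℝ) (z : ℍ) : ‖dilateIm s z‖ ^ 2 = ‖(z.re : ℍ)‖ ^ 2 + s ^ 2 * ‖z.im‖ ^ 2 := by
  have horth : ⟪(z.re : ℍ), s • z.im⟫ = 0 := by rw [inner_smul_right, inner_coe_re_im, mul_zero]
  have h := norm_add_sq_eq_norm_sq_add_norm_sq_real horth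
  rw [dilateIm_eq_re_add, sq, h, norm_smul, Real.norm_eq_abs, sq, sq, sq, ← abs_mul_abs_self s]; ring

/-- ★ **Ball agreement off a thin axial layer** (pair letters): unless `1 − s²‖x_⊥‖² ≤ ‖x̄‖² < 1`, the ball condition at scale `s` agrees with
its limit: `‖D_s x‖ < 1 ↔ ‖x̄‖ < 1`. [folklore] -/
theorem dilate_ball_iff {s : ℝ} {x : ℍ} (h : ‖axPart x‖ ^ 2 + s ^ 2 * ‖trPart x‖ ^ 2 < 1 ∨ 1 ≤ ‖axPart x‖ ^ 2) :
    (‖dilate s x‖ < 1 ↔ ‖axPart x‖ < 1) := by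
  rw [← sq_lt_one_iff₀ (norm_nonneg _), ← sq_lt_one_iff₀ (norm_nonneg (axPart x)), norm_dilate_sq]
  have hst : 0 ≤ s ^ 2 * ‖trPart x‖ ^ 2 := by positivity
  rcases h with h | h
  · exact ⟨fun _ => by linarith, fun _ => h⟩
  · exact ⟨fun h' => by linarith, fun h' => absurd h' (not_lt.2 h)⟩

/-- ★ **Ball agreement off a thin layer** (slaved letter): unless `1 − s²‖ζ‖² ≤ z₀² < 1`, `‖D³_s z‖ < 1 ↔ |z₀| < 1`. [folklore] -/
theorem dilateIm_ball_iff {s : ℝ} {z : ℍ} (h : ‖(z.re : ℍ)‖ ^ 2 + s ^ 2 * ‖z.im‖ ^ 2 < 1 ∨ 1 ≤ ‖(z.re : ℍ)‖ ^ 2) :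
    (‖dilateIm s z‖ < 1 ↔ ‖(z.re : ℍ)‖ < 1) := by
  rw [← sq_lt_one_iff₀ (norm_nonneg _), ← sq_lt_one_iff₀ (norm_nonneg (z.re : ℍ)), norm_dilateIm_sq]
  have hst : 0 ≤ s ^ 2 * ‖z.im‖ ^ 2 := by positivity
  rcases h with h | h
  · exact ⟨fun _ => by linarith, fun _ => h⟩
  · exact ⟨fun h' => by linarith, fun h' => absurd h' (not_lt.2 h)⟩

end Summit.QuantumFields.YangMills.Theorems.SwapVirialDeficit.ZeroModeSigma

end
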